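import Mathlib.RingTheory.Nullstellensatz
import Mathlib.RingTheory.Ideal.KrullsHeightTheorem
import Mathlib.Algebra.MvPolynomial.NoZeroDivisors
import Mathlib.Algebra.MvPolynomial.Nilpotent
import Mathlib.RingTheory.MvPolynomial.Homogeneous
import Mathlib.RingTheory.MvPolynomial.Ideal
import Literature.AlgebraicGeometry.Motives.HypersurfaceFormsNonsingular
import Literature.AlgebraicGeometry.Motives.VarietiesDimensionProofs
import HarnessLib

/-!
# A nonsingular form in at least three variables is irreducible

For a field `K` and a homogeneous form `F ∈ K[x₀, …, x_{n+1}]` of degree `d ≥ 1` with `n ≥ 1`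
(at least three variables) which is nonsingular in the sense of the projective Jacobian criterion
(`Literature.AlgebraicGeometry.Motives.SmoothHypersurface.IsNonsingularForm`,
`Motives/HypersurfaceFormsNonsingular`: every prime containing `F` and all `∂F/∂xⱼ` contains all
the variables), `F` is irreducible: `IsNonsingularForm.irreducible`. This is the geometric
argument of Hartshorne, *Algebraic Geometry*, II Example 8.20.2 ("we conclude in fact that `Y` is
irreducible, hence a nonsingular variety", since two hypersurfaces of `ℙᵐ`, `m ≥ 2`, meet and a
reducible hypersurface is singular along the intersection of two components), which
`Motives/HypersurfaceFormsIrreducible` replaced by Eisenstein for specific forms; the universal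
family of smooth hypersurfaces (`Motives/UniversalHypersurfaceFibre`) needs it for ALL nonsingular
forms (geometric irreducibility of the fibres).

## Proof

* `exists_isHomogeneous_mul_eq`: if the non-zero form `F` factors as `G · H` with non-units `G, H`,
  then `F = G' · H'` with `G', H'` the top homogeneous components of `G, H`, homogeneous of
  POSITIVE degrees (total degrees add in a domain, Mathlib `totalDegree_mul_of_isDomain`; compare
  homogeneous components of degree `deg G + deg H`).
* The ideal `(G', H')` lies in the maximal ideal `𝔪₀` of the origin (forms of positive degree
  vanish at `0`; Mathlib `MvPolynomial.vanishingIdeal`), so it has a minimal prime `𝔭 ⊆ 𝔪₀`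
  (Mathlib `Ideal.exists_minimalPrimes_le`); by **Krull's height theorem** (Mathlib
  `Ideal.height_le_card_of_mem_minimalPrimes_span_finset`) `ht 𝔭 ≤ 2`, while `ht 𝔪₀ = n + 2 ≥ 3`
  (`Literature.AlgebraicGeometry.Motives.MvPolynomial.height_eq_of_isMaximal`,
  `Motives/VarietiesDimensionProofs`); hence `𝔭 ≠ 𝔪₀` and some variable `xᵢ ∉ 𝔭` (a polynomial
  without constant term lies in `(x₀, …, x_{n+1})`). This is Hartshorne I Thm. 7.2 (projective
  dimension theorem) in the amount needed: `V₊(G') ∩ V₊(H') ≠ ∅`.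
* `F = G'H' ∈ 𝔭` and `∂ⱼF = ∂ⱼG' · H' + G' · ∂ⱼH' ∈ 𝔭`, contradicting nonsingularity at `xᵢ`.

## References

* R. Hartshorne, *Algebraic Geometry*, GTM 52 (1977): I Thm. 7.2, I Ex. 5.8, II Example 8.20.2.
  [Hartshorne1977]
-/

noncomputable section

open MvPolynomial

universe u

namespace Literature.AlgebraicGeometry.Motives.SmoothHypersurface

/-! ### Factors of forms -/

section Factors

variable {K : Type u} [Field K] {σ : Type*}

/-- Subtracting the top homogeneous component lowers the total degree (for polynomials of positive
degree). [folklore] -/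
theorem totalDegree_sub_homogeneousComponent_lt {H : MvPolynomial σ K} (hb : 1 ≤ H.totalDegree) :
    (H - homogeneousComponent H.totalDegree H).totalDegree < H.totalDegree := by
  set b := H.totalDegree with hb_def
  have hsum := sum_homogeneousComponent H
  rw [← hb_def, Finset.sum_range_succ] at hsum
  have hrest : H - homogeneousComponent b H =
      ∑ i ∈ Finset.range b, homogeneousComponent i H := by
    rw [sub_eq_iff_eq_add, hsum]
  rw [hrest]
  refine lt_of_le_of_lt (totalDegree_finsetSum _ _) ?_
  have hb0 : (⊥ : ℕ) < b := by rw [bot_eq_zero]; omega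
  rw [Finset.sup_lt_iff hb0]
  intro i hi
  exact lt_of_le_of_lt (homogeneousComponent_isHomogeneous i H).totalDegree_le
    (Finset.mem_range.mp hi)

/-- A non-zero non-unit polynomial over a field has positive total degree (constants are units).
[folklore] -/
theorem one_le_totalDegree_of_not_isUnit {G : MvPolynomial σ K} (hG0 : G ≠ 0) (hG : ¬ IsUnit G) :
    1 ≤ G.totalDegree := by
  by_contra h
  have h0 : G.totalDegree = 0 := by omega
  apply hG
  rw [totalDegree_eq_zero_iff_eq_C] at h0
  rw [h0]
  refine (isUnit_iff_ne_zero.mpr fun hc => hG0 ?_).map C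
  rw [h0, hc, map_zero]

/-- **Factors of a form are forms up to lower-order terms**: if a non-zero homogeneous `F` factors
as `G · H` with `G`, `H` non-units, then `F = G' · H'` with `G'`, `H'` homogeneous of positive
degrees, namely the top homogeneous components of `G` and `H` (degrees add in a domain).
[folklore] -/
theorem exists_isHomogeneous_mul_eq {d : ℕ} {F G H : MvPolynomial σ K} (hF : F.IsHomogeneous d)
    (hF0 : F ≠ 0) (hGH : F = G * H) (hG : ¬ IsUnit G) (hH : ¬ IsUnit H) :
    ∃ (a b : ℕ) (G' H' : MvPolynomial σ K), 1 ≤ a ∧ 1 ≤ b ∧ G'.IsHomogeneous a ∧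
      H'.IsHomogeneous b ∧ F = G' * H' := by
  have hG0 : G ≠ 0 := fun h => hF0 (by rw [hGH, h, zero_mul])
  have hH0 : H ≠ 0 := fun h => hF0 (by rw [hGH, h, mul_zero])
  set a := G.totalDegree with ha_def
  set b := H.totalDegree with hb_def
  have ha : 1 ≤ a := one_le_totalDegree_of_not_isUnit hG0 hG
  have hb : 1 ≤ b := one_le_totalDegree_of_not_isUnit hH0 hH
  set g := homogeneousComponent a G
  set h := homogeneousComponent b H
  have hg : g.IsHomogeneous a := homogeneousComponent_isHomogeneous a G
  have hh : h.IsHomogeneous b := homogeneousComponent_isHomogeneous b H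
  refine ⟨a, b, g, h, ha, hb, hg, hh, ?_⟩
  set G₁ := G - g
  set H₁ := H - h
  have hG₁ : G₁.totalDegree < a := totalDegree_sub_homogeneousComponent_lt ha
  have hH₁ : H₁.totalDegree < b := totalDegree_sub_homogeneousComponent_lt hb
  have hdeg : d = a + b := by
    rw [← hF.totalDegree hF0, hGH, totalDegree_mul_of_isDomain hG0 hH0]
  have hsplit : F = g * h + (g * H₁ + G₁ * h + G₁ * H₁) := by
    rw [hGH]
    have e1 : G = g + G₁ := by simp [G₁]
    have e2 : H = h + H₁ := by simp [H₁]
    rw [e1, e2]; ring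
  have hrest : (g * H₁ + G₁ * h + G₁ * H₁).totalDegree < a + b := by
    refine lt_of_le_of_lt (totalDegree_add _ _) (max_lt (lt_of_le_of_lt (totalDegree_add _ _)
      (max_lt ?_ ?_)) ?_)
    · refine lt_of_le_of_lt (totalDegree_mul _ _) ?_
      have := hg.totalDegree_le
      omega
    · refine lt_of_le_of_lt (totalDegree_mul _ _) ?_
      have := hh.totalDegree_le
      omega
    · refine lt_of_le_of_lt (totalDegree_mul _ _) ?_
      omega
  have key := congrArg (homogeneousComponent (a + b)) hsplit
  rw [map_add, homogeneousComponent_of_mem (hdeg ▸ hF), homogeneousComponent_of_mem (hg.mul hh),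
    homogeneousComponent_eq_zero (a + b) _ hrest, if_pos rfl, if_pos rfl, add_zero] at key
  exact key

end Factors

/-! ### Nonsingular forms are irreducible -/

section Irreducible

variable {K : Type u} [Field K] {n : ℕ}

/-- A nonsingular form is non-zero (the zero ideal is prime and misses the variables). [folklore] -/
theorem IsNonsingularForm.ne_zero {F : MvPolynomial (Fin (n + 2)) K} (hns : IsNonsingularForm K F) :
    F ≠ 0 := by
  rintro rfl
  have h := hns ⊥ Ideal.isPrime_bot (Submodule.zero_mem _) (fun j => by simp) 0
  exact X_ne_zero _ (Ideal.mem_bot.mp h)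

/-- Forms of positive degree have no constant term. [folklore] -/
theorem coeff_zero_of_isHomogeneous {d : ℕ} (hd : 1 ≤ d) {G : MvPolynomial (Fin (n + 2)) K}
    (hG : G.IsHomogeneous d) : coeff 0 G = 0 :=
  hG.coeff_eq_zero (by rw [map_zero]; omega)

/-- Evaluation at the origin is the constant coefficient. [folklore] -/
theorem aeval_zero_eq_coeff_zero (P : MvPolynomial (Fin (n + 2)) K) :
    aeval (0 : Fin (n + 2) → K) P = coeff 0 P := by
  rw [aeval_zero, Algebra.algebraMap_self, RingHom.id_apply]
  rfl

/-- A polynomial without constant term lies in the ideal of the variables (Mathlib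
`MvPolynomial.mem_ideal_span_X_image`). [folklore] -/
theorem mem_span_X_of_coeff_zero {G : MvPolynomial (Fin (n + 2)) K} (hG : coeff 0 G = 0) :
    G ∈ Ideal.span (Set.range (X : Fin (n + 2) → MvPolynomial (Fin (n + 2)) K)) := by
  rw [← Set.image_univ, mem_ideal_span_X_image]
  intro m hm
  by_contra! h
  have : m = 0 := Finsupp.ext fun i => h i (Set.mem_univ i)
  rw [this] at hm
  exact (mem_support_iff.mp hm) hG

/-- **A nonsingular form of degree `d ≥ 1` in at least three variables is irreducible**
(Hartshorne II Example 8.20.2, via I Thm. 7.2: two hypersurfaces of `ℙⁿ⁺¹`, `n ≥ 1`, meet — here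
by Krull's height theorem, a minimal prime of `(G', H')` inside the maximal ideal of the origin
has height `≤ 2 < n + 2` — and `F = G'H'` is singular along `V(G') ∩ V(H')`).
[cite: Hartshorne1977, II Example 8.20.2 and I Thm. 7.2] -/
theorem IsNonsingularForm.irreducible (hn : 1 ≤ n) {d : ℕ} (hd : 1 ≤ d)
    {F : MvPolynomial (Fin (n + 2)) K} (hF : F.IsHomogeneous d) (hns : IsNonsingularForm K F) :
    Irreducible F := by
  have hF0 := hns.ne_zero
  refine irreducible_iff.mpr ⟨fun hu => ?_, fun G H hGH => ?_⟩
  · have h0 := ((isUnit_iff_totalDegree_of_isReduced).mp hu).2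
    rw [hF.totalDegree hF0] at h0
    omega
  classical
  by_contra hGH'
  push Not at hGH'
  obtain ⟨a, b, G', H', ha, hb, hG', hH', hfac⟩ :=
    exists_isHomogeneous_mul_eq hF hF0 hGH hGH'.1 hGH'.2
  -- the maximal ideal of the origin
  let J : Ideal (MvPolynomial (Fin (n + 2)) K) :=
    MvPolynomial.vanishingIdeal K {(0 : Fin (n + 2) → K)}
  have hJmem : ∀ {e : ℕ} {P : MvPolynomial (Fin (n + 2)) K}, 1 ≤ e → P.IsHomogeneous e → P ∈ J :=
    fun he hP => by
      rw [MvPolynomial.mem_vanishingIdeal_singleton_iff, aeval_zero_eq_coeff_zero,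
        coeff_zero_of_isHomogeneous he hP]
  let I : Ideal (MvPolynomial (Fin (n + 2)) K) := Ideal.span ({G', H'} : Finset _)
  have hIJ : I ≤ J := by
    refine Ideal.span_le.mpr ?_
    intro P hP
    simp only [Finset.coe_insert, Finset.coe_singleton, Set.mem_insert_iff,
      Set.mem_singleton_iff] at hP
    rcases hP with rfl | rfl
    · exact hJmem ha hG'
    · exact hJmem hb hH'
  obtain ⟨𝔭, h𝔭min, h𝔭J⟩ := Ideal.exists_minimalPrimes_le hIJ
  have h𝔭prime : 𝔭.IsPrime := h𝔭min.1.1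
  have hI𝔭 : I ≤ 𝔭 := h𝔭min.1.2
  have hG'𝔭 : G' ∈ 𝔭 := hI𝔭 (Ideal.subset_span (by simp))
  have hH'𝔭 : H' ∈ 𝔭 := hI𝔭 (Ideal.subset_span (by simp))
  -- `𝔭` misses some variable: otherwise `𝔭 = J` would have height `≤ 2 < n + 2`
  obtain ⟨i, hi⟩ : ∃ i, (X i : MvPolynomial (Fin (n + 2)) K) ∉ 𝔭 := by
    by_contra! hall
    have hJ𝔭 : J ≤ 𝔭 := fun P hP => by
      have hP0 : coeff 0 P = 0 := by
        have := (MvPolynomial.mem_vanishingIdeal_singleton_iff _ _).mp hP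
        rwa [aeval_zero_eq_coeff_zero] at this
      exact Ideal.span_le.mpr (Set.range_subset_iff.mpr hall) (mem_span_X_of_coeff_zero hP0)
    have heq : 𝔭 = J := le_antisymm h𝔭J hJ𝔭
    have hht : 𝔭.height ≤ 2 := by
      refine (Ideal.height_le_card_of_mem_minimalPrimes_span_finset h𝔭min).trans ?_
      exact_mod_cast Finset.card_le_two
    rw [heq, MvPolynomial.height_eq_of_isMaximal K (n + 2) J] at hht
    norm_cast at hht
    omega
  refine hi (hns 𝔭 h𝔭prime ?_ (fun j => ?_) i)
  · rw [hfac]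
    exact Ideal.mul_mem_right _ _ hG'𝔭
  · rw [hfac, pderiv_mul]
    exact Ideal.add_mem _ (Ideal.mul_mem_left _ _ hH'𝔭) (Ideal.mul_mem_right _ _ hG'𝔭)

/-- Hence a nonsingular form of degree `d ≥ 1` in at least three variables is prime (`K[x]` is
factorial). [folklore] -/
theorem IsNonsingularForm.prime (hn : 1 ≤ n) {d : ℕ} (hd : 1 ≤ d)
    {F : MvPolynomial (Fin (n + 2)) K} (hF : F.IsHomogeneous d) (hns : IsNonsingularForm K F) :
    Prime F :=
  (hns.irreducible hn hd hF).prime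

end Irreducible

end Literature.AlgebraicGeometry.Motives.SmoothHypersurface

end
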